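import Literature.NumberTheory.Transcendental.KaehlerHodgeHarmonicCounterexample
import HarnessLib

/-!
# The named fact `charmonicForms_eq_iSup_dolbeaultHarmonicForms` is false as stated (the rigged torus)

Theorems-only companion of `Literature/NumberTheory/Transcendental/KaehlerHodge.lean` (C12) and of
`KaehlerHodgeHarmonicCounterexample.lean` (the rigged torus on which `ℋ^{1,1}_{∂̄} ≤ ℋ²_ℂ` fails); cf.
`KaehlerHodgeDecompositionGlueProofs.lean` (filed separately: in every degree the decomposition contains
`ℋ^{p,q}_{∂̄} ≤ ℋᵏ_ℂ`, `dolbeaultHarmonicForms_le_charmonicForms_of_eq_iSup`, and at a complex manifold it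
follows from the Kähler identity, `charmonicForms_eq_iSup_dolbeaultHarmonicForms_of_kaehlerIdentity`).

`KaehlerHodge.lean` records Voisin's Corollary 6.10 (Hodge Theory and Complex Algebraic Geometry I,
§6.1.2, p. 142, `ℋᵏ(X) = ⨁_{p+q=k} ℋ^{p,q}` on a Kähler manifold, with `ℋ^{p,q}` "by theorem 6.7 …
also the set of forms of type `(p,q)` which are harmonic for `Δ_∂̄`") as
`Literature.NumberTheory.Transcendental.charmonicForms_eq_iSup_dolbeaultHarmonicForms g o`, a
`def … : Prop` written in `section Kaehler` after
`variable … [IsManifold 𝓘(ℂ, E) ω M] [IsManifold 𝓘(ℝ, E) ∞ M] (g …) (o …)`. Its body mentions `g` and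
`o` but not the complex structure, so the `def` abstracts
`E, M, k, m, [FiniteDimensional ℂ E], n, [Fact (finrank ℝ E = n)], [IsManifold 𝓘(ℝ, E) ∞ M], g, o` and
**not** the holomorphic atlas `[IsManifold 𝓘(ℂ, E) ω M]` — the defect shared by all the facts of
sections `Hermitian` and `Kaehler` of that file (module docstring of `KaehlerHodge.lean`, *Correction*
and *Restatement as predicates*). Read as a closed named fact (universally quantified over exactly those
binders) it therefore speaks about every real `C^∞` manifold charted on `E`, with `IsOfType`, `∂̄`,
`∂̄*`, `Δ_∂̄` read in the preferred charts of a merely smooth atlas, and in that generality it is false.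
This file proves so, reusing the witness of `KaehlerHodgeHarmonicCounterexample.lean`: the torus
`T = (ℝ/ℤ)²` charted on `ℂ` by the `{id, conj}`-rigged real-analytic atlas
`TorusConjAtlas.chartedSpaceT` (`KaehlerHodgeDolbeaultHarmonicCounterexample.lean`), its flat metric
`TorusConjAtlas.metric` — smooth, and Kähler in the sense of `IsKaehler` — and the orientation family
`TorusConjAtlas.orient` (smooth volume form), in degree `k = 2`, `m = 0`: there the smooth `(1,1)`-form
`TorusConjAtlas.alpha` lies in `ℋ^{1,1}_{∂̄}` but not in `ℋ²_ℂ`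
(`TorusConjAtlas.alpha_mem_dolbeaultHarmonicForms`, `TorusConjAtlas.alpha_not_mem_charmonicForms`),
whereas the decomposition `ℋ²_ℂ = ⨆_{p+q=2} ℋ^{p,q}_{∂̄}` contains `ℋ^{1,1}_{∂̄}` as the summand
`(p, q) = (1, 1)`.

* `TorusConjAtlas.not_charmonicForms_eq_iSup_dolbeaultHarmonicForms_torus`: the predicate fails for
  `(T, metric, orient)` in degree `2`;
* `not_forall_charmonicForms_eq_iSup_dolbeaultHarmonicForms`: hence it fails over real `C^∞` surfaces
  charted in `ℂ`;
* `not_charmonicForms_eq_iSup_dolbeaultHarmonicForms`: **the universal closure of the named fact over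
  exactly its elaborated binders is false** — no closed proof
  `charmonicForms_eq_iSup_dolbeaultHarmonicForms_holds` can exist. The intended statement (Voisin,
  Cor. 6.10; Huybrechts (2005), Prop. 3.2.6 (ii)) carries the complex-manifold hypothesis, under which
  the predicate is reduced to the Kähler identity `Δ_d = 2Δ_∂̄` (Thm. 6.7) by
  `charmonicForms_eq_iSup_dolbeaultHarmonicForms_of_kaehlerIdentity`
  (`KaehlerHodgeDecompositionGlueProofs.lean`, filed separately).

Nothing here is deep; no definition and no named fact is introduced.

## References

* C. Voisin, *Hodge Theory and Complex Algebraic Geometry I*, Cambridge Studies in Advanced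
  Mathematics 76 (2002), §6.1.2, Thm. 6.7 (p. 141), Cor. 6.10 (p. 142). [Voisin2002]
* D. Huybrechts, *Complex Geometry* (2005), Prop. 3.1.12 (iii), Prop. 3.2.6 (ii).
-/

noncomputable section

open scoped Manifold ContDiff
open Bundle Module

namespace Literature.NumberTheory.Transcendental

namespace TorusConjAtlas

section Charts

attribute [local instance] chartedSpaceT isManifoldT bundle Complex.finrank_real_complex_fact

/-- **The named fact `charmonicForms_eq_iSup_dolbeaultHarmonicForms` is false for the rigged torus**
(`E = ℂ`, `n = 2`, degree `k = 2`, `m = 0`, the flat `C^∞` metric `metric`, which is Kähler in the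
sense of `IsKaehler`, and the orientation family `orient`, whose volume form is smooth): under the
decomposition `ℋ²_ℂ = ⨆_{p+q=2} ℋ^{p,q}_{∂̄}` the form `α = (F(x) vol) ⊗ 1 ∈ ℋ^{1,1}_{∂̄}`
(`alpha_mem_dolbeaultHarmonicForms`) would lie in the summand `(1, 1)` of the right-hand side, hence
in `ℋ²_ℂ`, which it does not (`alpha_not_mem_charmonicForms`: `Δ_d α ≠ 0`). [folklore] -/
theorem not_charmonicForms_eq_iSup_dolbeaultHarmonicForms_torus :
    ¬ charmonicForms_eq_iSup_dolbeaultHarmonicForms (k := 1 + 1) (m := 0) metric orient := by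
  intro H
  have h2 : (1 + 1 + 0 : ℕ) = 2 := rfl
  exact alpha_not_mem_charmonicForms h2 ((H isKaehler h2 isSmoothForm_riemannianVolumeForm).ge
    (Submodule.mem_iSup_of_mem (1, 1) (Submodule.mem_iSup_of_mem (Finset.mem_antidiagonal.mpr rfl)
      (alpha_mem_dolbeaultHarmonicForms h2))))

end Charts

end TorusConjAtlas

section UniversalClosure

attribute [local instance] TorusConjAtlas.chartedSpaceT TorusConjAtlas.isManifoldT
  Complex.finrank_real_complex_fact

/-- **`charmonicForms_eq_iSup_dolbeaultHarmonicForms` fails already over real `C^∞` surfaces charted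
in `ℂ`** (smooth metric, any orientation family), in degree `k = 2`, `m = 0`: witness the rigged torus
`TorusConjAtlas.T` with the flat metric
(`TorusConjAtlas.not_charmonicForms_eq_iSup_dolbeaultHarmonicForms_torus`). The intended statement is
Voisin (2002), §6.1.2, Cor. 6.10, for Kähler — in particular complex — manifolds. [folklore] -/
theorem not_forall_charmonicForms_eq_iSup_dolbeaultHarmonicForms :
    ¬ ∀ (M : Type) [TopologicalSpace M] [ChartedSpace ℂ M] [IsManifold 𝓘(ℝ, ℂ) ∞ M]
        (g : ContMDiffRiemannianMetric 𝓘(ℝ, ℂ) ∞ ℂ (fun x : M ↦ TangentSpace 𝓘(ℝ, ℂ) x))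
        (o : (x : M) → Orientation ℝ (TangentSpace 𝓘(ℝ, ℂ) x) (Fin 2)),
        charmonicForms_eq_iSup_dolbeaultHarmonicForms (k := 1 + 1) (m := 0) g o :=
  fun H ↦ TorusConjAtlas.not_charmonicForms_eq_iSup_dolbeaultHarmonicForms_torus
    (H TorusConjAtlas.T TorusConjAtlas.metric TorusConjAtlas.orient)

/-- **The named fact `charmonicForms_eq_iSup_dolbeaultHarmonicForms` is false as stated.** Closed
universally over exactly the binders it elaborates with — a finite-dimensional complex normed space `E`
with `finrank ℝ E = n`, a charted space `M` over `E` that is a *real* `C^∞` manifold (no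
`[IsManifold 𝓘(ℂ, E) ω M]`: the section instance is not mentioned in the body of the `def` and was
therefore not abstracted), degrees `k`, `m`, a `C^∞` Riemannian metric `g` and an orientation family
`o` — the statement fails: witness `E = ℂ`, `n = 2`, `k = 2`, `m = 0`, the torus `(ℝ/ℤ)²` with the
`{id, conj}`-rigged real-analytic atlas `TorusConjAtlas.chartedSpaceT`, the flat (Kähler) metric and the
orientation `TorusConjAtlas.orient` (`TorusConjAtlas.not_charmonicForms_eq_iSup_dolbeaultHarmonicForms_torus`).
Hence no closed proof `charmonicForms_eq_iSup_dolbeaultHarmonicForms_holds` can exist. The intended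
statement — Voisin (2002), §6.1.2, Cor. 6.10 (p. 142); Huybrechts (2005), Prop. 3.2.6 (ii) — carries the
complex-manifold hypothesis; under it the predicate is reduced to the corrected Kähler identity
`cHodgeLaplacian_eq_two_smul_dolbeaultLaplacian_of_isManifold_complex` by
`charmonicForms_eq_iSup_dolbeaultHarmonicForms_of_kaehlerIdentity` (`KaehlerHodgeDecompositionGlueProofs.lean`).
[folklore] -/
theorem not_charmonicForms_eq_iSup_dolbeaultHarmonicForms :
    ¬ ∀ {E : Type} [NormedAddCommGroup E] [NormedSpace ℂ E] {M : Type} [TopologicalSpace M]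
        [ChartedSpace E M] {k m : ℕ} [FiniteDimensional ℂ E] {n : ℕ} [Fact (finrank ℝ E = n)]
        [IsManifold 𝓘(ℝ, E) ∞ M]
        (g : ContMDiffRiemannianMetric 𝓘(ℝ, E) ∞ E (fun x : M ↦ TangentSpace 𝓘(ℝ, E) x))
        (o : (x : M) → Orientation ℝ (TangentSpace 𝓘(ℝ, E) x) (Fin n)),
        charmonicForms_eq_iSup_dolbeaultHarmonicForms (k := k) (m := m) g o :=
  fun H ↦ not_forall_charmonicForms_eq_iSup_dolbeaultHarmonicForms fun M _ _ _ g o ↦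
    @H ℂ _ _ M _ _ (1 + 1) 0 _ 2 Complex.finrank_real_complex_fact _ g o

end UniversalClosure

end Literature.NumberTheory.Transcendental
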